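import Mathlib
import Summits.Ventures.PercRepro2.CoinChainXAJpCore

/-!
# The (j, j′) markers, family B (`γ_m ≤ 0`): the algebraic core — the TRIANGLE corner argument
(blind cell PercRepro2, night-2 g29; proofs/NIGHT2-DARC.md §71)

When the coefficient `γ_m` of the `m`-fibre gate mass is nonpositive, the naive box bound `w_m ≤ u_m·T/U` loses the
monotonicity `θ_m ≤ θ_mj, θ_mj'` of the relative openness, and the resulting corners are false (§70.5).  The right bound
is `γ_m·w_m ≥ γ_m·u_m·min(θ_mj, θ_mj')`: after the case split `u_mj'·w_mj ≤ u_mj·w_mj'` (or its mirror) and the comparable-pair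
fact `u_mj·w_m ≤ u_m·w_mj`, the functional is bounded below by a function AFFINE in `(x, y, z) = (U·w_mj, U·w_mj', U·w_jj')` on
the triangle `0 ≤ x/X ≤ y/Y ≤ 1` times the interval `[0, Z·T]` (the `j`-side collapsed as in §70.7).  Its six corners are the
top gate, `↑{m, j'}`, the M-gate `↑{m}`, and the same three with the `j`-side open — the certified family-A corners `J`, `J + mj'`
and the open gate.  `triangle_nonneg_of_corners` is the interpolation lemma (no positivity of the box needed);
`xa_jp_core_B_caseA` / `_caseB` are the two mirror cases, `xa_jp_core_B_deg` the degenerate case `u_mj = u_mj' = 0`, and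
`xa_jp_core_B` the core (the case split on `le_total`, the degenerate fibres by hand).
-/

namespace Summit.Ventures.PercRepro2.Coin

section JpCoreB

variable {R : Type*} [Field R] [LinearOrder R] [IsStrictOrderedRing R]

/-- Triangle interpolation: a function affine in `(x, y)` on the triangle `0 ≤ x·Y ≤ y·X`, `0 ≤ y ≤ Y`, `x ≤ X`
(i.e. `0 ≤ x/X ≤ y/Y ≤ 1`) is nonnegative once its three corner values at `(0, 0)`, `(0, Y)`, `(X, Y)` are. -/
lemma triangle_nonneg_of_corners (K0 K1 K2 x y X Y : R) (hx : 0 ≤ x) (hy : 0 ≤ y) (hxX : x ≤ X) (hyY : y ≤ Y)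
    (hxy : x * Y ≤ y * X) (c00 : 0 ≤ K0) (c0Y : 0 ≤ K0 + K2 * Y) (cXY : 0 ≤ K0 + K1 * X + K2 * Y) :
    0 ≤ K0 + K1 * x + K2 * y := by
  rcases eq_or_lt_of_le (hx.trans hxX) with hX | hX
  · have hx0 : x = 0 := le_antisymm (hX ▸ hxX) hx
    subst hx0
    have := affine_nonneg_of_endpoints K0 K2 y Y hy hyY c00 c0Y
    linarith
  · rcases eq_or_lt_of_le (hy.trans hyY) with hY | hY
    · have hy0 : y = 0 := le_antisymm (hY ▸ hyY) hy
      subst hy0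
      have hY0 : Y = 0 := hY.symm
      subst hY0
      have := affine_nonneg_of_endpoints K0 K1 x X hx hxX c00 (by linarith)
      linarith
    · have e : X * Y * (K0 + K1 * x + K2 * y)
          = x * Y * (K0 + K1 * X + K2 * Y) + (y * X - x * Y) * (K0 + K2 * Y) + X * (Y - y) * K0 := by ring
      have key : 0 ≤ X * Y * (K0 + K1 * x + K2 * y) := by
        rw [e]
        have t1 : 0 ≤ x * Y * (K0 + K1 * X + K2 * Y) := mul_nonneg (mul_nonneg hx hY.le) cXY
        have t2 : 0 ≤ (y * X - x * Y) * (K0 + K2 * Y) := mul_nonneg (sub_nonneg.2 hxy) c0Y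
        have t3 : 0 ≤ X * (Y - y) * K0 := mul_nonneg (mul_nonneg hX.le (sub_nonneg.2 hyY)) c00
        linarith
      exact nonneg_of_mul_nonneg_of_pos _ _ (mul_pos hX hY) key

/-- The affine-in-`(x, y, z)` bound of family B: `Φ(x, y, z) = P0 + Px·x + Py·y + Pz·z` with `(x, y)` in the triangle and
`z ∈ [0, Z]`, nonnegative at its six corners, is nonnegative. -/
lemma triangle_interval_nonneg_of_corners (P0 Px Py Pz x y z X Y Z : R) (hx : 0 ≤ x) (hy : 0 ≤ y) (hxX : x ≤ X)
    (hyY : y ≤ Y) (hxy : x * Y ≤ y * X) (hz : 0 ≤ z) (hzZ : z ≤ Z)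
    (c00 : 0 ≤ P0) (c0Y : 0 ≤ P0 + Py * Y) (cXY : 0 ≤ P0 + Px * X + Py * Y)
    (d00 : 0 ≤ P0 + Pz * Z) (d0Y : 0 ≤ P0 + Py * Y + Pz * Z) (dXY : 0 ≤ P0 + Px * X + Py * Y + Pz * Z) :
    0 ≤ P0 + Px * x + Py * y + Pz * z := by
  have h0 := triangle_nonneg_of_corners P0 Px Py x y X Y hx hy hxX hyY hxy c00 c0Y cXY
  have hZ := triangle_nonneg_of_corners (P0 + Pz * Z) Px Py x y X Y hx hy hxX hyY hxy d00 (by linarith) (by linarith)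
  have := affine_nonneg_of_endpoints (P0 + Px * x + Py * y) Pz z Z hz hzZ h0 (by linarith)
  linarith

set_option maxHeartbeats 3200000 in
set_option maxRecDepth 100000 in
/-- Family B, the case `θ_mj ≤ θ_mjp` with `u_mj > 0`: the bound `u_mj·w_m ≤ u_m·w_mj`, the triangle `0 ≤ x/X ≤ y/Y ≤ 1`
in `(x, y) = (U·w_mj, U·w_mjp)`, the interval in `z = U·w_jj'`. -/
lemma xa_jp_core_B_caseA (F₀ gm gj gjp gjjp gmj gmjp gmjjp um uj ujp ujjp umj umjp umjjp wm wj wjp wjjp wmj wmjp wmjjp : R)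
    (hgj : gj ≤ 0) (hgjp : gjp ≤ 0) (hγ : gm ≤ 0)
    (_hum : 0 ≤ um) (_huj : 0 ≤ uj) (_hujp : 0 ≤ ujp) (humj : 0 ≤ umj) (_humjp : 0 ≤ umjp)
    (_hwm : 0 ≤ wm) (_hwj : 0 ≤ wj) (_hwjp : 0 ≤ wjp) (_hwjjp : 0 ≤ wjjp) (_hwmj : 0 ≤ wmj) (_hwmjp : 0 ≤ wmjp) (hwmjjp : 0 ≤ wmjjp)
    (hTU : wmjjp ≤ umjjp) (_hw_mj : wmj ≤ umj) (_hw_mjp : wmjp ≤ umjp)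
    (hmono_j : ujjp * wj ≤ uj * wjjp) (hmono_jp : ujjp * wjp ≤ ujp * wjjp)
    (hmono_m_mj : umj * wm ≤ um * wmj) (_hmono_m_mjp : umjp * wm ≤ um * wmjp)
    (_htop_m : umjjp * wm ≤ um * wmjjp)
    (htop_mj : umjjp * wmj ≤ umj * wmjjp) (htop_mjp : umjjp * wmjp ≤ umjp * wmjjp) (htop_jjp : umjjp * wjjp ≤ ujjp * wmjjp)
    (hU : 0 < umjjp) (hJJ : 0 < ujjp)
    (hF0 : 0 ≤ F₀)
    (hC_top : 0 ≤ umjjp * (F₀ + gmjjp * umjjp))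
    (_hC_mj : 0 ≤ umjjp * (F₀ + gmj * umj + gmjjp * umjjp))
    (hC_mjp : 0 ≤ umjjp * (F₀ + gmjp * umjp + gmjjp * umjjp))
    (hC_M : 0 ≤ umjjp * (F₀ + gm * um + gmj * umj + gmjp * umjp + gmjjp * umjjp))
    (hC_J : 0 ≤ umjjp * (F₀ + gj * uj + gjp * ujp + gjjp * ujjp + gmjjp * umjjp))
    (_hC_J_mj : 0 ≤ umjjp * (F₀ + gj * uj + gjp * ujp + gjjp * ujjp + gmj * umj + gmjjp * umjjp))
    (hC_J_mjp : 0 ≤ umjjp * (F₀ + gj * uj + gjp * ujp + gjjp * ujjp + gmjp * umjp + gmjjp * umjjp))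
    (hC_open : 0 ≤ umjjp * (F₀ + gm * um + gj * uj + gjp * ujp + gjjp * ujjp + gmj * umj + gmjp * umjp + gmjjp * umjjp))
    (hpos : 0 < umj) (hcase : umjp * wmj ≤ umj * wmjp) :
    0 ≤ F₀ + gm * wm + gj * wj + gjp * wjp + gjjp * wjjp + gmj * wmj + gmjp * wmjp + gmjjp * wmjjp := by
  have hT0 : 0 ≤ wmjjp := hwmjjp
  have hTUd : 0 ≤ umjjp - wmjjp := sub_nonneg.2 hTU
  have tj : 0 ≤ gj * (ujjp * wj - uj * wjjp) := mul_nonneg_of_nonpos_of_nonpos hgj (sub_nonpos.2 hmono_j)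
  have tjp : 0 ≤ gjp * (ujjp * wjp - ujp * wjjp) := mul_nonneg_of_nonpos_of_nonpos hgjp (sub_nonpos.2 hmono_jp)
  have tm : 0 ≤ gm * (umj * wm - um * wmj) := mul_nonneg_of_nonpos_of_nonpos hγ (sub_nonpos.2 hmono_m_mj)
  set Lj := gj * uj + gjp * ujp + gjjp * ujjp with hLj
  have hx0 : 0 ≤ umjjp * wmj := by positivity
  have hy0 : 0 ≤ umjjp * wmjp := by positivity
  have hz0 : 0 ≤ umjjp * wjjp := by positivity
  have hxy : (umjjp * wmj) * (umjp * wmjjp) ≤ (umjjp * wmjp) * (umj * wmjjp) := by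
    have h := mul_le_mul_of_nonneg_right hcase (mul_nonneg hU.le hT0)
    linarith [h]
  have c00 : 0 ≤ ujjp * umj * umjjp ^ 2 * (F₀ + gmjjp * wmjjp) := by
    have e : ujjp * umj * umjjp ^ 2 * (F₀ + gmjjp * wmjjp) = ujjp * umj * (umjjp * (umjjp - wmjjp) * F₀ + wmjjp * (umjjp * (F₀ + gmjjp * umjjp))) := by ring
    rw [e]; exact mul_nonneg (mul_nonneg hJJ.le humj) (add_nonneg (mul_nonneg (mul_nonneg hU.le hTUd) hF0) (mul_nonneg hT0 hC_top))
  have c0Y : 0 ≤ ujjp * umj * umjjp ^ 2 * (F₀ + gmjjp * wmjjp) + ujjp * umj * umjjp * gmjp * (umjp * wmjjp) := by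
    have e : ujjp * umj * umjjp ^ 2 * (F₀ + gmjjp * wmjjp) + ujjp * umj * umjjp * gmjp * (umjp * wmjjp) = ujjp * umj * (umjjp * (umjjp - wmjjp) * F₀ + wmjjp * (umjjp * (F₀ + gmjp * umjp + gmjjp * umjjp))) := by ring
    rw [e]; exact mul_nonneg (mul_nonneg hJJ.le humj) (add_nonneg (mul_nonneg (mul_nonneg hU.le hTUd) hF0) (mul_nonneg hT0 hC_mjp))
  have cXY : 0 ≤ ujjp * umj * umjjp ^ 2 * (F₀ + gmjjp * wmjjp) + ujjp * umjjp * (um * gm + umj * gmj) * (umj * wmjjp) + ujjp * umj * umjjp * gmjp * (umjp * wmjjp) := by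
    have e : ujjp * umj * umjjp ^ 2 * (F₀ + gmjjp * wmjjp) + ujjp * umjjp * (um * gm + umj * gmj) * (umj * wmjjp) + ujjp * umj * umjjp * gmjp * (umjp * wmjjp) = ujjp * umj * (umjjp * (umjjp - wmjjp) * F₀ + wmjjp * (umjjp * (F₀ + gm * um + gmj * umj + gmjp * umjp + gmjjp * umjjp))) := by ring
    rw [e]; exact mul_nonneg (mul_nonneg hJJ.le humj) (add_nonneg (mul_nonneg (mul_nonneg hU.le hTUd) hF0) (mul_nonneg hT0 hC_M))
  have d00 : 0 ≤ ujjp * umj * umjjp ^ 2 * (F₀ + gmjjp * wmjjp) + umj * umjjp * Lj * (ujjp * wmjjp) := by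
    have e : ujjp * umj * umjjp ^ 2 * (F₀ + gmjjp * wmjjp) + umj * umjjp * Lj * (ujjp * wmjjp) = ujjp * umj * (umjjp * (umjjp - wmjjp) * F₀ + wmjjp * (umjjp * (F₀ + gj * uj + gjp * ujp + gjjp * ujjp + gmjjp * umjjp))) := by rw [hLj]; ring
    rw [e]; exact mul_nonneg (mul_nonneg hJJ.le humj) (add_nonneg (mul_nonneg (mul_nonneg hU.le hTUd) hF0) (mul_nonneg hT0 hC_J))
  have d0Y : 0 ≤ ujjp * umj * umjjp ^ 2 * (F₀ + gmjjp * wmjjp) + ujjp * umj * umjjp * gmjp * (umjp * wmjjp) + umj * umjjp * Lj * (ujjp * wmjjp) := by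
    have e : ujjp * umj * umjjp ^ 2 * (F₀ + gmjjp * wmjjp) + ujjp * umj * umjjp * gmjp * (umjp * wmjjp) + umj * umjjp * Lj * (ujjp * wmjjp) = ujjp * umj * (umjjp * (umjjp - wmjjp) * F₀ + wmjjp * (umjjp * (F₀ + gj * uj + gjp * ujp + gjjp * ujjp + gmjp * umjp + gmjjp * umjjp))) := by rw [hLj]; ring
    rw [e]; exact mul_nonneg (mul_nonneg hJJ.le humj) (add_nonneg (mul_nonneg (mul_nonneg hU.le hTUd) hF0) (mul_nonneg hT0 hC_J_mjp))
  have dXY : 0 ≤ ujjp * umj * umjjp ^ 2 * (F₀ + gmjjp * wmjjp) + ujjp * umjjp * (um * gm + umj * gmj) * (umj * wmjjp) + ujjp * umj * umjjp * gmjp * (umjp * wmjjp) + umj * umjjp * Lj * (ujjp * wmjjp) := by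
    have e : ujjp * umj * umjjp ^ 2 * (F₀ + gmjjp * wmjjp) + ujjp * umjjp * (um * gm + umj * gmj) * (umj * wmjjp) + ujjp * umj * umjjp * gmjp * (umjp * wmjjp) + umj * umjjp * Lj * (ujjp * wmjjp) = ujjp * umj * (umjjp * (umjjp - wmjjp) * F₀ + wmjjp * (umjjp * (F₀ + gm * um + gj * uj + gjp * ujp + gjjp * ujjp + gmj * umj + gmjp * umjp + gmjjp * umjjp))) := by rw [hLj]; ring
    rw [e]; exact mul_nonneg (mul_nonneg hJJ.le humj) (add_nonneg (mul_nonneg (mul_nonneg hU.le hTUd) hF0) (mul_nonneg hT0 hC_open))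
  have hΦ := triangle_interval_nonneg_of_corners (ujjp * umj * umjjp ^ 2 * (F₀ + gmjjp * wmjjp)) (ujjp * umjjp * (um * gm + umj * gmj)) (ujjp * umj * umjjp * gmjp) (umj * umjjp * Lj) (umjjp * wmj) (umjjp * wmjp) (umjjp * wjjp) (umj * wmjjp) (umjp * wmjjp) (ujjp * wmjjp)
    hx0 hy0 htop_mj htop_mjp hxy hz0 htop_jjp c00 c0Y cXY d00 d0Y dXY
  have hident : umj * ujjp * umjjp ^ 2 * (F₀ + gm * wm + gj * wj + gjp * wjp + gjjp * wjjp + gmj * wmj + gmjp * wmjp + gmjjp * wmjjp)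
      = (ujjp * umj * umjjp ^ 2 * (F₀ + gmjjp * wmjjp) + ujjp * umjjp * (um * gm + umj * gmj) * (umjjp * wmj) + ujjp * umj * umjjp * gmjp * (umjjp * wmjp) + umj * umjjp * Lj * (umjjp * wjjp))
        + umjjp * (ujjp * umjjp * (gm * (umj * wm - um * wmj)) + umj * umjjp * (gj * (ujjp * wj - uj * wjjp) + gjp * (ujjp * wjp - ujp * wjjp))) := by
    rw [hLj]; ring
  have key : 0 ≤ umj * ujjp * umjjp ^ 2 * (F₀ + gm * wm + gj * wj + gjp * wjp + gjjp * wjjp + gmj * wmj + gmjp * wmjp + gmjjp * wmjjp) := by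
    rw [hident]
    have h1 := mul_nonneg (mul_nonneg hJJ.le hU.le) tm
    have h2 := mul_nonneg (mul_nonneg humj hU.le) (add_nonneg tj tjp)
    have h3 := mul_nonneg hU.le (add_nonneg h1 h2)
    linarith
  exact nonneg_of_mul_nonneg_of_pos _ _ (mul_pos (mul_pos hpos hJJ) (pow_pos hU 2)) key

set_option maxHeartbeats 3200000 in
set_option maxRecDepth 100000 in
/-- Family B, the case `θ_mjp ≤ θ_mj` with `u_mjp > 0`: the bound `u_mjp·w_m ≤ u_m·w_mjp`, the triangle `0 ≤ x/X ≤ y/Y ≤ 1`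
in `(x, y) = (U·w_mjp, U·w_mj)`, the interval in `z = U·w_jj'`. -/
lemma xa_jp_core_B_caseB (F₀ gm gj gjp gjjp gmj gmjp gmjjp um uj ujp ujjp umj umjp umjjp wm wj wjp wjjp wmj wmjp wmjjp : R)
    (hgj : gj ≤ 0) (hgjp : gjp ≤ 0) (hγ : gm ≤ 0)
    (_hum : 0 ≤ um) (_huj : 0 ≤ uj) (_hujp : 0 ≤ ujp) (_humj : 0 ≤ umj) (humjp : 0 ≤ umjp)
    (_hwm : 0 ≤ wm) (_hwj : 0 ≤ wj) (_hwjp : 0 ≤ wjp) (_hwjjp : 0 ≤ wjjp) (_hwmj : 0 ≤ wmj) (_hwmjp : 0 ≤ wmjp) (hwmjjp : 0 ≤ wmjjp)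
    (hTU : wmjjp ≤ umjjp) (_hw_mj : wmj ≤ umj) (_hw_mjp : wmjp ≤ umjp)
    (hmono_j : ujjp * wj ≤ uj * wjjp) (hmono_jp : ujjp * wjp ≤ ujp * wjjp)
    (_hmono_m_mj : umj * wm ≤ um * wmj) (hmono_m_mjp : umjp * wm ≤ um * wmjp)
    (_htop_m : umjjp * wm ≤ um * wmjjp)
    (htop_mj : umjjp * wmj ≤ umj * wmjjp) (htop_mjp : umjjp * wmjp ≤ umjp * wmjjp) (htop_jjp : umjjp * wjjp ≤ ujjp * wmjjp)
    (hU : 0 < umjjp) (hJJ : 0 < ujjp)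
    (hF0 : 0 ≤ F₀)
    (hC_top : 0 ≤ umjjp * (F₀ + gmjjp * umjjp))
    (hC_mj : 0 ≤ umjjp * (F₀ + gmj * umj + gmjjp * umjjp))
    (_hC_mjp : 0 ≤ umjjp * (F₀ + gmjp * umjp + gmjjp * umjjp))
    (hC_M : 0 ≤ umjjp * (F₀ + gm * um + gmj * umj + gmjp * umjp + gmjjp * umjjp))
    (hC_J : 0 ≤ umjjp * (F₀ + gj * uj + gjp * ujp + gjjp * ujjp + gmjjp * umjjp))
    (hC_J_mj : 0 ≤ umjjp * (F₀ + gj * uj + gjp * ujp + gjjp * ujjp + gmj * umj + gmjjp * umjjp))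
    (_hC_J_mjp : 0 ≤ umjjp * (F₀ + gj * uj + gjp * ujp + gjjp * ujjp + gmjp * umjp + gmjjp * umjjp))
    (hC_open : 0 ≤ umjjp * (F₀ + gm * um + gj * uj + gjp * ujp + gjjp * ujjp + gmj * umj + gmjp * umjp + gmjjp * umjjp))
    (hpos : 0 < umjp) (hcase : umj * wmjp ≤ umjp * wmj) :
    0 ≤ F₀ + gm * wm + gj * wj + gjp * wjp + gjjp * wjjp + gmj * wmj + gmjp * wmjp + gmjjp * wmjjp := by
  have hT0 : 0 ≤ wmjjp := hwmjjp
  have hTUd : 0 ≤ umjjp - wmjjp := sub_nonneg.2 hTU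
  have tj : 0 ≤ gj * (ujjp * wj - uj * wjjp) := mul_nonneg_of_nonpos_of_nonpos hgj (sub_nonpos.2 hmono_j)
  have tjp : 0 ≤ gjp * (ujjp * wjp - ujp * wjjp) := mul_nonneg_of_nonpos_of_nonpos hgjp (sub_nonpos.2 hmono_jp)
  have tm : 0 ≤ gm * (umjp * wm - um * wmjp) := mul_nonneg_of_nonpos_of_nonpos hγ (sub_nonpos.2 hmono_m_mjp)
  set Lj := gj * uj + gjp * ujp + gjjp * ujjp with hLj
  have hx0 : 0 ≤ umjjp * wmjp := by positivity
  have hy0 : 0 ≤ umjjp * wmj := by positivity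
  have hz0 : 0 ≤ umjjp * wjjp := by positivity
  have hxy : (umjjp * wmjp) * (umj * wmjjp) ≤ (umjjp * wmj) * (umjp * wmjjp) := by
    have h := mul_le_mul_of_nonneg_right hcase (mul_nonneg hU.le hT0)
    linarith [h]
  have c00 : 0 ≤ ujjp * umjp * umjjp ^ 2 * (F₀ + gmjjp * wmjjp) := by
    have e : ujjp * umjp * umjjp ^ 2 * (F₀ + gmjjp * wmjjp) = ujjp * umjp * (umjjp * (umjjp - wmjjp) * F₀ + wmjjp * (umjjp * (F₀ + gmjjp * umjjp))) := by ring
    rw [e]; exact mul_nonneg (mul_nonneg hJJ.le humjp) (add_nonneg (mul_nonneg (mul_nonneg hU.le hTUd) hF0) (mul_nonneg hT0 hC_top))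
  have c0Y : 0 ≤ ujjp * umjp * umjjp ^ 2 * (F₀ + gmjjp * wmjjp) + ujjp * umjp * umjjp * gmj * (umj * wmjjp) := by
    have e : ujjp * umjp * umjjp ^ 2 * (F₀ + gmjjp * wmjjp) + ujjp * umjp * umjjp * gmj * (umj * wmjjp) = ujjp * umjp * (umjjp * (umjjp - wmjjp) * F₀ + wmjjp * (umjjp * (F₀ + gmj * umj + gmjjp * umjjp))) := by ring
    rw [e]; exact mul_nonneg (mul_nonneg hJJ.le humjp) (add_nonneg (mul_nonneg (mul_nonneg hU.le hTUd) hF0) (mul_nonneg hT0 hC_mj))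
  have cXY : 0 ≤ ujjp * umjp * umjjp ^ 2 * (F₀ + gmjjp * wmjjp) + ujjp * umjjp * (um * gm + umjp * gmjp) * (umjp * wmjjp) + ujjp * umjp * umjjp * gmj * (umj * wmjjp) := by
    have e : ujjp * umjp * umjjp ^ 2 * (F₀ + gmjjp * wmjjp) + ujjp * umjjp * (um * gm + umjp * gmjp) * (umjp * wmjjp) + ujjp * umjp * umjjp * gmj * (umj * wmjjp) = ujjp * umjp * (umjjp * (umjjp - wmjjp) * F₀ + wmjjp * (umjjp * (F₀ + gm * um + gmj * umj + gmjp * umjp + gmjjp * umjjp))) := by ring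
    rw [e]; exact mul_nonneg (mul_nonneg hJJ.le humjp) (add_nonneg (mul_nonneg (mul_nonneg hU.le hTUd) hF0) (mul_nonneg hT0 hC_M))
  have d00 : 0 ≤ ujjp * umjp * umjjp ^ 2 * (F₀ + gmjjp * wmjjp) + umjp * umjjp * Lj * (ujjp * wmjjp) := by
    have e : ujjp * umjp * umjjp ^ 2 * (F₀ + gmjjp * wmjjp) + umjp * umjjp * Lj * (ujjp * wmjjp) = ujjp * umjp * (umjjp * (umjjp - wmjjp) * F₀ + wmjjp * (umjjp * (F₀ + gj * uj + gjp * ujp + gjjp * ujjp + gmjjp * umjjp))) := by rw [hLj]; ring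
    rw [e]; exact mul_nonneg (mul_nonneg hJJ.le humjp) (add_nonneg (mul_nonneg (mul_nonneg hU.le hTUd) hF0) (mul_nonneg hT0 hC_J))
  have d0Y : 0 ≤ ujjp * umjp * umjjp ^ 2 * (F₀ + gmjjp * wmjjp) + ujjp * umjp * umjjp * gmj * (umj * wmjjp) + umjp * umjjp * Lj * (ujjp * wmjjp) := by
    have e : ujjp * umjp * umjjp ^ 2 * (F₀ + gmjjp * wmjjp) + ujjp * umjp * umjjp * gmj * (umj * wmjjp) + umjp * umjjp * Lj * (ujjp * wmjjp) = ujjp * umjp * (umjjp * (umjjp - wmjjp) * F₀ + wmjjp * (umjjp * (F₀ + gj * uj + gjp * ujp + gjjp * ujjp + gmj * umj + gmjjp * umjjp))) := by rw [hLj]; ring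
    rw [e]; exact mul_nonneg (mul_nonneg hJJ.le humjp) (add_nonneg (mul_nonneg (mul_nonneg hU.le hTUd) hF0) (mul_nonneg hT0 hC_J_mj))
  have dXY : 0 ≤ ujjp * umjp * umjjp ^ 2 * (F₀ + gmjjp * wmjjp) + ujjp * umjjp * (um * gm + umjp * gmjp) * (umjp * wmjjp) + ujjp * umjp * umjjp * gmj * (umj * wmjjp) + umjp * umjjp * Lj * (ujjp * wmjjp) := by
    have e : ujjp * umjp * umjjp ^ 2 * (F₀ + gmjjp * wmjjp) + ujjp * umjjp * (um * gm + umjp * gmjp) * (umjp * wmjjp) + ujjp * umjp * umjjp * gmj * (umj * wmjjp) + umjp * umjjp * Lj * (ujjp * wmjjp) = ujjp * umjp * (umjjp * (umjjp - wmjjp) * F₀ + wmjjp * (umjjp * (F₀ + gm * um + gj * uj + gjp * ujp + gjjp * ujjp + gmj * umj + gmjp * umjp + gmjjp * umjjp))) := by rw [hLj]; ring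
    rw [e]; exact mul_nonneg (mul_nonneg hJJ.le humjp) (add_nonneg (mul_nonneg (mul_nonneg hU.le hTUd) hF0) (mul_nonneg hT0 hC_open))
  have hΦ := triangle_interval_nonneg_of_corners (ujjp * umjp * umjjp ^ 2 * (F₀ + gmjjp * wmjjp)) (ujjp * umjjp * (um * gm + umjp * gmjp)) (ujjp * umjp * umjjp * gmj) (umjp * umjjp * Lj) (umjjp * wmjp) (umjjp * wmj) (umjjp * wjjp) (umjp * wmjjp) (umj * wmjjp) (ujjp * wmjjp)
    hx0 hy0 htop_mjp htop_mj hxy hz0 htop_jjp c00 c0Y cXY d00 d0Y dXY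
  have hident : umjp * ujjp * umjjp ^ 2 * (F₀ + gm * wm + gj * wj + gjp * wjp + gjjp * wjjp + gmj * wmj + gmjp * wmjp + gmjjp * wmjjp)
      = (ujjp * umjp * umjjp ^ 2 * (F₀ + gmjjp * wmjjp) + ujjp * umjjp * (um * gm + umjp * gmjp) * (umjjp * wmjp) + ujjp * umjp * umjjp * gmj * (umjjp * wmj) + umjp * umjjp * Lj * (umjjp * wjjp))
        + umjjp * (ujjp * umjjp * (gm * (umjp * wm - um * wmjp)) + umjp * umjjp * (gj * (ujjp * wj - uj * wjjp) + gjp * (ujjp * wjp - ujp * wjjp))) := by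
    rw [hLj]; ring
  have key : 0 ≤ umjp * ujjp * umjjp ^ 2 * (F₀ + gm * wm + gj * wj + gjp * wjp + gjjp * wjjp + gmj * wmj + gmjp * wmjp + gmjjp * wmjjp) := by
    rw [hident]
    have h1 := mul_nonneg (mul_nonneg hJJ.le hU.le) tm
    have h2 := mul_nonneg (mul_nonneg humjp hU.le) (add_nonneg tj tjp)
    have h3 := mul_nonneg hU.le (add_nonneg h1 h2)
    linarith
  exact nonneg_of_mul_nonneg_of_pos _ _ (mul_pos (mul_pos hpos hJJ) (pow_pos hU 2)) key

set_option maxHeartbeats 3200000 in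
set_option maxRecDepth 100000 in
/-- Family B, the degenerate case `w_mj = w_mj' = 0`: the bound of `w_m` by the top fibre, the interval in `z = U·w_jj'`. -/
lemma xa_jp_core_B_deg (F₀ gm gj gjp gjjp gmj gmjp gmjjp um uj ujp ujjp umj umjp umjjp wm wj wjp wjjp wmj wmjp wmjjp : R)
    (hgj : gj ≤ 0) (hgjp : gjp ≤ 0) (hγ : gm ≤ 0)
    (_hum : 0 ≤ um) (_huj : 0 ≤ uj) (_hujp : 0 ≤ ujp) (_humj : 0 ≤ umj) (_humjp : 0 ≤ umjp)
    (_hwm : 0 ≤ wm) (_hwj : 0 ≤ wj) (_hwjp : 0 ≤ wjp) (_hwjjp : 0 ≤ wjjp) (hwmj : 0 ≤ wmj) (hwmjp : 0 ≤ wmjp) (hwmjjp : 0 ≤ wmjjp)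
    (hTU : wmjjp ≤ umjjp) (hw_mj : wmj ≤ umj) (hw_mjp : wmjp ≤ umjp)
    (hmono_j : ujjp * wj ≤ uj * wjjp) (hmono_jp : ujjp * wjp ≤ ujp * wjjp)
    (_hmono_m_mj : umj * wm ≤ um * wmj) (_hmono_m_mjp : umjp * wm ≤ um * wmjp)
    (htop_m : umjjp * wm ≤ um * wmjjp)
    (_htop_mj : umjjp * wmj ≤ umj * wmjjp) (_htop_mjp : umjjp * wmjp ≤ umjp * wmjjp) (htop_jjp : umjjp * wjjp ≤ ujjp * wmjjp)
    (hU : 0 < umjjp) (hJJ : 0 < ujjp)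
    (hF0 : 0 ≤ F₀)
    (_hC_top : 0 ≤ umjjp * (F₀ + gmjjp * umjjp))
    (_hC_mj : 0 ≤ umjjp * (F₀ + gmj * umj + gmjjp * umjjp))
    (_hC_mjp : 0 ≤ umjjp * (F₀ + gmjp * umjp + gmjjp * umjjp))
    (hC_M : 0 ≤ umjjp * (F₀ + gm * um + gmj * umj + gmjp * umjp + gmjjp * umjjp))
    (_hC_J : 0 ≤ umjjp * (F₀ + gj * uj + gjp * ujp + gjjp * ujjp + gmjjp * umjjp))
    (_hC_J_mj : 0 ≤ umjjp * (F₀ + gj * uj + gjp * ujp + gjjp * ujjp + gmj * umj + gmjjp * umjjp))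
    (_hC_J_mjp : 0 ≤ umjjp * (F₀ + gj * uj + gjp * ujp + gjjp * ujjp + gmjp * umjp + gmjjp * umjjp))
    (hC_open : 0 ≤ umjjp * (F₀ + gm * um + gj * uj + gjp * ujp + gjjp * ujjp + gmj * umj + gmjp * umjp + gmjjp * umjjp))
    (hmj0 : umj = 0) (hmjp0 : umjp = 0) :
    0 ≤ F₀ + gm * wm + gj * wj + gjp * wjp + gjjp * wjjp + gmj * wmj + gmjp * wmjp + gmjjp * wmjjp := by
  subst hmj0 hmjp0
  have hwmj0 : wmj = 0 := le_antisymm hw_mj hwmj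
  have hwmjp0 : wmjp = 0 := le_antisymm hw_mjp hwmjp
  subst hwmj0 hwmjp0
  have hT0 : 0 ≤ wmjjp := hwmjjp
  have hTUd : 0 ≤ umjjp - wmjjp := sub_nonneg.2 hTU
  have tj : 0 ≤ gj * (ujjp * wj - uj * wjjp) := mul_nonneg_of_nonpos_of_nonpos hgj (sub_nonpos.2 hmono_j)
  have tjp : 0 ≤ gjp * (ujjp * wjp - ujp * wjjp) := mul_nonneg_of_nonpos_of_nonpos hgjp (sub_nonpos.2 hmono_jp)
  have tm : 0 ≤ gm * (umjjp * wm - um * wmjjp) := mul_nonneg_of_nonpos_of_nonpos hγ (sub_nonpos.2 htop_m)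
  set Lj := gj * uj + gjp * ujp + gjjp * ujjp with hLj
  have hz0 : 0 ≤ umjjp * wjjp := by positivity
  have c0 : 0 ≤ ujjp * umjjp ^ 2 * (F₀ + gmjjp * wmjjp) + ujjp * umjjp * gm * um * wmjjp := by
    have e : ujjp * umjjp ^ 2 * (F₀ + gmjjp * wmjjp) + ujjp * umjjp * gm * um * wmjjp = ujjp * (umjjp * (umjjp - wmjjp) * F₀ + wmjjp * (umjjp * (F₀ + gm * um + gmj * 0 + gmjp * 0 + gmjjp * umjjp))) := by ring
    rw [e]; exact mul_nonneg hJJ.le (add_nonneg (mul_nonneg (mul_nonneg hU.le hTUd) hF0) (mul_nonneg hT0 hC_M))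
  have cZ : 0 ≤ ujjp * umjjp ^ 2 * (F₀ + gmjjp * wmjjp) + ujjp * umjjp * gm * um * wmjjp + umjjp * Lj * (ujjp * wmjjp) := by
    have e : ujjp * umjjp ^ 2 * (F₀ + gmjjp * wmjjp) + ujjp * umjjp * gm * um * wmjjp + umjjp * Lj * (ujjp * wmjjp) = ujjp * (umjjp * (umjjp - wmjjp) * F₀ + wmjjp * (umjjp * (F₀ + gm * um + gj * uj + gjp * ujp + gjjp * ujjp + gmj * 0 + gmjp * 0 + gmjjp * umjjp))) := by rw [hLj]; ring
    rw [e]; exact mul_nonneg hJJ.le (add_nonneg (mul_nonneg (mul_nonneg hU.le hTUd) hF0) (mul_nonneg hT0 hC_open))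
  have hΦ := affine_nonneg_of_endpoints (ujjp * umjjp ^ 2 * (F₀ + gmjjp * wmjjp) + ujjp * umjjp * gm * um * wmjjp) (umjjp * Lj) (umjjp * wjjp) (ujjp * wmjjp) hz0 htop_jjp c0 cZ
  have hident : ujjp * umjjp ^ 2 * (F₀ + gm * wm + gj * wj + gjp * wjp + gjjp * wjjp + gmj * 0 + gmjp * 0 + gmjjp * wmjjp)
      = (ujjp * umjjp ^ 2 * (F₀ + gmjjp * wmjjp) + ujjp * umjjp * gm * um * wmjjp + umjjp * Lj * (umjjp * wjjp))
        + umjjp * (ujjp * (gm * (umjjp * wm - um * wmjjp)) + umjjp * (gj * (ujjp * wj - uj * wjjp) + gjp * (ujjp * wjp - ujp * wjjp))) := by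
    rw [hLj]; ring
  have key : 0 ≤ ujjp * umjjp ^ 2 * (F₀ + gm * wm + gj * wj + gjp * wjp + gjjp * wjjp + gmj * 0 + gmjp * 0 + gmjjp * wmjjp) := by
    rw [hident]
    have h1 := mul_nonneg hJJ.le tm
    have h2 := mul_nonneg hU.le (add_nonneg tj tjp)
    have h3 := mul_nonneg hU.le (add_nonneg h1 h2)
    linarith
  exact nonneg_of_mul_nonneg_of_pos _ _ (mul_pos hJJ (pow_pos hU 2)) key

/-- **THE ABSTRACT CORE OF THE (j, j′) ARGUMENT, FAMILY B** (`gm ≤ 0`): `F₀` the closed-gate value, `ge` the gate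
coefficients, `ue`, `we` the coin and gate fibre masses; the monotone facts `j, j' ⊆ jj'` and `m ⊆ mj, mj'`, the bounds by
the top fibre (also for `m`), the positivity of `umjjp`, `ujjp`, and the eight corner inequalities (top, `mj`, `mj'`, the
M-gate, `J`, `J + mj`, `J + mj'`, open) with the closed gate.  Then `F ≥ 0`. -/
theorem xa_jp_core_B (F₀ gm gj gjp gjjp gmj gmjp gmjjp um uj ujp ujjp umj umjp umjjp wm wj wjp wjjp wmj wmjp wmjjp : R)
    (hgj : gj ≤ 0) (hgjp : gjp ≤ 0) (hγ : gm ≤ 0)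
    (hum : 0 ≤ um) (huj : 0 ≤ uj) (hujp : 0 ≤ ujp) (humj : 0 ≤ umj) (humjp : 0 ≤ umjp)
    (hwm : 0 ≤ wm) (hwj : 0 ≤ wj) (hwjp : 0 ≤ wjp) (hwjjp : 0 ≤ wjjp) (hwmj : 0 ≤ wmj) (hwmjp : 0 ≤ wmjp) (hwmjjp : 0 ≤ wmjjp)
    (hTU : wmjjp ≤ umjjp) (hw_mj : wmj ≤ umj) (hw_mjp : wmjp ≤ umjp)
    (hmono_j : ujjp * wj ≤ uj * wjjp) (hmono_jp : ujjp * wjp ≤ ujp * wjjp)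
    (hmono_m_mj : umj * wm ≤ um * wmj) (hmono_m_mjp : umjp * wm ≤ um * wmjp)
    (htop_m : umjjp * wm ≤ um * wmjjp)
    (htop_mj : umjjp * wmj ≤ umj * wmjjp) (htop_mjp : umjjp * wmjp ≤ umjp * wmjjp) (htop_jjp : umjjp * wjjp ≤ ujjp * wmjjp)
    (hU : 0 < umjjp) (hJJ : 0 < ujjp)
    (hF0 : 0 ≤ F₀)
    (hC_top : 0 ≤ umjjp * (F₀ + gmjjp * umjjp))
    (hC_mj : 0 ≤ umjjp * (F₀ + gmj * umj + gmjjp * umjjp))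
    (hC_mjp : 0 ≤ umjjp * (F₀ + gmjp * umjp + gmjjp * umjjp))
    (hC_M : 0 ≤ umjjp * (F₀ + gm * um + gmj * umj + gmjp * umjp + gmjjp * umjjp))
    (hC_J : 0 ≤ umjjp * (F₀ + gj * uj + gjp * ujp + gjjp * ujjp + gmjjp * umjjp))
    (hC_J_mj : 0 ≤ umjjp * (F₀ + gj * uj + gjp * ujp + gjjp * ujjp + gmj * umj + gmjjp * umjjp))
    (hC_J_mjp : 0 ≤ umjjp * (F₀ + gj * uj + gjp * ujp + gjjp * ujjp + gmjp * umjp + gmjjp * umjjp))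
    (hC_open : 0 ≤ umjjp * (F₀ + gm * um + gj * uj + gjp * ujp + gjjp * ujjp + gmj * umj + gmjp * umjp + gmjjp * umjjp)) :
    0 ≤ F₀ + gm * wm + gj * wj + gjp * wjp + gjjp * wjjp + gmj * wmj + gmjp * wmjp + gmjjp * wmjjp := by
  rcases le_total (umjp * wmj) (umj * wmjp) with hA | hB
  · rcases eq_or_lt_of_le humj with hmjz | hmjpos
    · have hwmj0 : wmj = 0 := le_antisymm (hmjz ▸ hw_mj) hwmj
      rcases eq_or_lt_of_le humjp with hmjpz | hmjppos
      · exact xa_jp_core_B_deg F₀ gm gj gjp gjjp gmj gmjp gmjjp um uj ujp ujjp umj umjp umjjp wm wj wjp wjjp wmj wmjp wmjjp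
          hgj hgjp hγ hum huj hujp humj humjp hwm hwj hwjp hwjjp hwmj hwmjp hwmjjp hTU hw_mj hw_mjp hmono_j hmono_jp
          hmono_m_mj hmono_m_mjp htop_m htop_mj htop_mjp htop_jjp hU hJJ hF0 hC_top hC_mj hC_mjp hC_M hC_J hC_J_mj hC_J_mjp hC_open
          hmjz.symm hmjpz.symm
      · have hB' : umj * wmjp ≤ umjp * wmj := by rw [hwmj0, ← hmjz]; simp
        exact xa_jp_core_B_caseB F₀ gm gj gjp gjjp gmj gmjp gmjjp um uj ujp ujjp umj umjp umjjp wm wj wjp wjjp wmj wmjp wmjjp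
          hgj hgjp hγ hum huj hujp humj humjp hwm hwj hwjp hwjjp hwmj hwmjp hwmjjp hTU hw_mj hw_mjp hmono_j hmono_jp
          hmono_m_mj hmono_m_mjp htop_m htop_mj htop_mjp htop_jjp hU hJJ hF0 hC_top hC_mj hC_mjp hC_M hC_J hC_J_mj hC_J_mjp hC_open
          hmjppos hB'
    · exact xa_jp_core_B_caseA F₀ gm gj gjp gjjp gmj gmjp gmjjp um uj ujp ujjp umj umjp umjjp wm wj wjp wjjp wmj wmjp wmjjp
        hgj hgjp hγ hum huj hujp humj humjp hwm hwj hwjp hwjjp hwmj hwmjp hwmjjp hTU hw_mj hw_mjp hmono_j hmono_jp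
        hmono_m_mj hmono_m_mjp htop_m htop_mj htop_mjp htop_jjp hU hJJ hF0 hC_top hC_mj hC_mjp hC_M hC_J hC_J_mj hC_J_mjp hC_open
        hmjpos hA
  · rcases eq_or_lt_of_le humjp with hmjpz | hmjppos
    · have hwmjp0 : wmjp = 0 := le_antisymm (hmjpz ▸ hw_mjp) hwmjp
      rcases eq_or_lt_of_le humj with hmjz | hmjpos
      · exact xa_jp_core_B_deg F₀ gm gj gjp gjjp gmj gmjp gmjjp um uj ujp ujjp umj umjp umjjp wm wj wjp wjjp wmj wmjp wmjjp
          hgj hgjp hγ hum huj hujp humj humjp hwm hwj hwjp hwjjp hwmj hwmjp hwmjjp hTU hw_mj hw_mjp hmono_j hmono_jp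
          hmono_m_mj hmono_m_mjp htop_m htop_mj htop_mjp htop_jjp hU hJJ hF0 hC_top hC_mj hC_mjp hC_M hC_J hC_J_mj hC_J_mjp hC_open
          hmjz.symm hmjpz.symm
      · have hA' : umjp * wmj ≤ umj * wmjp := by rw [hwmjp0, ← hmjpz]; simp
        exact xa_jp_core_B_caseA F₀ gm gj gjp gjjp gmj gmjp gmjjp um uj ujp ujjp umj umjp umjjp wm wj wjp wjjp wmj wmjp wmjjp
          hgj hgjp hγ hum huj hujp humj humjp hwm hwj hwjp hwjjp hwmj hwmjp hwmjjp hTU hw_mj hw_mjp hmono_j hmono_jp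
          hmono_m_mj hmono_m_mjp htop_m htop_mj htop_mjp htop_jjp hU hJJ hF0 hC_top hC_mj hC_mjp hC_M hC_J hC_J_mj hC_J_mjp hC_open
          hmjpos hA'
    · exact xa_jp_core_B_caseB F₀ gm gj gjp gjjp gmj gmjp gmjjp um uj ujp ujjp umj umjp umjjp wm wj wjp wjjp wmj wmjp wmjjp
        hgj hgjp hγ hum huj hujp humj humjp hwm hwj hwjp hwjjp hwmj hwmjp hwmjjp hTU hw_mj hw_mjp hmono_j hmono_jp
        hmono_m_mj hmono_m_mjp htop_m htop_mj htop_mjp htop_jjp hU hJJ hF0 hC_top hC_mj hC_mjp hC_M hC_J hC_J_mj hC_J_mjp hC_open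
        hmjppos hB

end JpCoreB

end Summit.Ventures.PercRepro2.Coin
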